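import Mathlib
import HarnessLib
import Summits.ValiantsHypothesis.ValiantsHypothesis.Theorems.EquivariantDialLayersCharacters
import Summits.ValiantsHypothesis.ValiantsHypothesis.Theorems.MonotoneRestorationMixingScaleSpechtDimLinear
import Literature.RepresentationTheory.FiniteGroups.SymmetricGroupIsotypic
import Literature.RepresentationTheory.FiniteGroups.IsotypicComponents
import Literature.RepresentationTheory.FiniteGroups.ProductGroupCharacters
import Literature.RepresentationTheory.FiniteGroups.SymmetricGroupHookCharacters
import Literature.NumberTheory.DiophantineGeometry.SymmetricGroupRepsFinrankSpechtProofs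
import Literature.Computability.AlgebraicComplexity.BLMW11StanleyRectangularCharacterProofs

/-!
# Equivariant dial, layered face — the non-abelian floor `(m-1)²` on the whole interior

Support for the cell `A = EqHardBiPerm` (item `stmt-ValiantsHypothesis-23702`, draft route `SymmetryDial`) via its
layered leaf `R^lay = IdealWidthSuperpoly` (`idealWidth (biPermSubst m) per_m d` = least number of degree-`d` forms
with window-stable span whose ideal contains `per_m`; window = `𝔖_m × 𝔖_m`).  HONEST FRAMING: `VP ≠ VNP` is NOT
proved here, nor `A`, nor `R^lay`, nor any super-polynomial bound.  This is a SIZE-FREE FLOOR CALIBRATION of the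
leaf by elementary character theory of `𝔖_m × 𝔖_m` — isotypic projectors + the minimal degree `m - 1` of `𝔖_m`
(`m ≥ 5`; James–Kerber 2.4.10 / Rasala 1977), textbook-grade, kernel-new only for the leaf; 0 definitions, 0 stubs,
0 named facts, 0 summit-currency.  It lifts the gcd-blind spot of `EquivariantDialLayersCharacters`
(`(m / gcd(m,d))²`, i.e. `4` on every middle cut `2d = m`) to `(m-1)²` AND NO FURTHER: type counting is capped at
`(m-1)²` when `gcd(m,d) > 1`; `m²` there and anything superpolynomial need MULTIPLICITIES of the forced type or
depth-2 (`DF₂`) objects.  WHY `m ≥ 5` is real: at `m = 4` the type `(2,2) ⊠ (2,2)` has dimension `4 = (m/gcd)²`.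
§1 a form of degree `≤ m - 2` dies under the row antisymmetriser `∑_σ sgn σ · (σ, 1)` (a monomial misses two rows
`i ≠ i'`; `σ ↦ σ (i i')` reverses the sign); columns via `Prod.swap`.  §2 the partitions escaping `f^λ ≥ m - 1` are
`(m)`, `(1ᵐ)` (`χ^λ(1) = f^λ` is `spechtCharacter_one_eq_numStandardTableaux`).  §3 `sq_sub_one_le_finrank`: in a
finite-dimensional `ℂ[𝔖_m × 𝔖_m]`-module a vector `v ≠ 0` killed by the row/column symmetrisers AND antisymmetrisers
has a non-zero isotypic component of a type `χ^λ ⊠ χ^μ`, `λ, μ ∉ {(m), (1ᵐ)}` (else the projector FACTORS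
through a vanishing (anti)symmetriser), whence `dim V ≥ dim V_χ ≥ χ(1) = f^λ f^μ ≥ (m-1)²`.  §4 the leaf: a
window-stable degree-`d` cut `s` of `per_m`
(`0 < d ≤ m - 2`) has some `p ∈ s` with `p(x_{ζ,ζ}) ≠ 0` (`ζ` a primitive `m`-th root of unity), and
`v = (1 - (1,c))(1 - (c,1)) p ∈ span s` (`c` the `m`-cycle) has `v(x_{ζ,ζ}) = (1 - ζ^d)² p(x_{ζ,ζ}) ≠ 0` and vanishing
(anti)symmetriser sums: **`(m-1)² ≤ r`**; with the coprime column `d = m - 1` (`m²`): **`(m-1)² ≤ idealWidth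
(biPermSubst m) per_m d` for all `m ≥ 5`, `0 < d < m`**, the middle cut included; record `max ((m/gcd)², (m-1)²)`.
Reused by import, not restated: `exists_eval_ne_zero_of_mem_idealSpan`, `rename_prodCongr_mem_span`,
`eval_powPoint_perPoly_ne_zero`, `eval_rename_shift_powPoint`, `sq_le_of_hasIdealWidthLE_of_coprime`,
`sq_div_gcd_le_idealWidth`, `isotypicProj_apply`, `sum_isotypicProj_apply`, `exists_eq_boxProd_of_mem_irrChars`,
`finrank_range_isotypicProj_eq_mul_finrank_intertwiningMap`, `irrChars_perm_eq`, `spechtCharacter_one_eq_numStandardTableaux`,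
`spechtCharacter_eq_one_of_card_parts_le_one`, `spechtCharacter_of_parts_eq_replicate_one`, `sub_one_le_numStandardTableaux`.
-/

set_option linter.dupNamespace false

namespace Summit.ValiantsHypothesis.ValiantsHypothesis.Theorems.EquivariantDialLayersSpecht

open MvPolynomial Matrix Literature.Computability.AlgebraicComplexity
open Literature.RepresentationTheory.FiniteGroups Literature.NumberTheory.DiophantineGeometry
open Summit.ValiantsHypothesis.ValiantsHypothesis.Theorems.EquivariantDialNode
open Summit.ValiantsHypothesis.ValiantsHypothesis.Theorems.EquivariantDialLayers
open Summit.ValiantsHypothesis.ValiantsHypothesis.Theorems.EquivariantDialLayersCharacters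
open Summit.ValiantsHypothesis.ValiantsHypothesis.Theorems.OrbitRestorationQPMixingScale.SpechtDim
open Equiv (Perm)

/-! ## §1 Row / column antisymmetrisers kill every form of degree `≤ m - 2` -/

/-- `∑_σ sgn σ · q(x_{σ i, j}) = 0` for `deg q ≤ m - 2`. [folklore] -/
theorem sum_sign_smul_rename_row_eq_zero {m : ℕ} {q : MvPolynomial (Fin m × Fin m) ℂ} (hq : q.totalDegree + 2 ≤ m) :
    ∑ σ : Perm (Fin m), ((Equiv.Perm.sign σ : ℤ) : ℂ) • rename (Equiv.prodCongr σ (1 : Perm (Fin m))) q = 0 := by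
  classical
  have key : ∀ α ∈ q.support, ∑ σ : Perm (Fin m), ((Equiv.Perm.sign σ : ℤ) : ℂ) •
      rename (Equiv.prodCongr σ (1 : Perm (Fin m))) (monomial α (coeff α q)) = 0 := by
    intro α hα
    have hrows : (α.support.image Prod.fst).card + 2 ≤ m := by
      have h1 : (α.support.image Prod.fst).card ≤ α.support.card := Finset.card_image_le
      have h2 : α.support.card ≤ α.sum (fun _ e => e) := by
        rw [Finsupp.sum, Finset.card_eq_sum_ones]
        exact Finset.sum_le_sum fun ij hij => Nat.one_le_iff_ne_zero.2 (Finsupp.mem_support_iff.1 hij)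
      have h3 := le_totalDegree hα
      omega
    obtain ⟨i, hi, i', hi', hii'⟩ : ∃ i ∈ Finset.univ \ α.support.image Prod.fst,
        ∃ i' ∈ Finset.univ \ α.support.image Prod.fst, i ≠ i' := by
      rw [← Finset.one_lt_card, Finset.card_univ_sdiff, Fintype.card_fin]
      omega
    set e := Equiv.prodCongr (Equiv.swap i i') (1 : Perm (Fin m)) with he
    have hfx : ∀ b ∈ α.support, e b = b := fun b hb => by
      have hb1 : b.1 ∈ α.support.image Prod.fst := Finset.mem_image_of_mem _ hb
      refine Prod.ext ?_ ?_ <;> simp [he, Equiv.swap_apply_of_ne_of_ne (fun h : b.1 = i => (Finset.mem_sdiff.1 hi).2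
        (h ▸ hb1)) (fun h : b.1 = i' => (Finset.mem_sdiff.1 hi').2 (h ▸ hb1))]
    have hmd : Finsupp.mapDomain e α = α := by
      ext ij
      obtain ⟨a, rfl⟩ := e.surjective ij
      rw [Finsupp.mapDomain_apply e.injective]
      by_cases ha : e a = a
      · rw [ha]
      · have h0 : ∀ b, e b ≠ b → α b = 0 := fun b hb => Finsupp.notMem_support_iff.1 fun hb' => hb (hfx b hb')
        rw [h0 a ha, h0 (e a) fun h => ha (e.injective h)]
    have hfix : rename e (monomial α (coeff α q)) = monomial α (coeff α q) := by rw [rename_monomial, hmd]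
    set S := ∑ σ : Perm (Fin m), ((Equiv.Perm.sign σ : ℤ) : ℂ) •
      rename (Equiv.prodCongr σ (1 : Perm (Fin m))) (monomial α (coeff α q))
    have hcomp : ∀ σ : Perm (Fin m), (⇑(Equiv.prodCongr (σ * Equiv.swap i i') (1 : Perm (Fin m))) :
        Fin m × Fin m → Fin m × Fin m) = ⇑(Equiv.prodCongr σ (1 : Perm (Fin m))) ∘ ⇑e :=
      fun σ => funext fun ⟨a, b⟩ => rfl
    have hneg : S = -S := by
      calc S = ∑ σ : Perm (Fin m), ((Equiv.Perm.sign (σ * Equiv.swap i i') : ℤ) : ℂ) •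
            rename (Equiv.prodCongr (σ * Equiv.swap i i') (1 : Perm (Fin m))) (monomial α (coeff α q)) :=
            (Fintype.sum_equiv (Equiv.mulRight (Equiv.swap i i')) _ _ fun σ => rfl).symm
        _ = ∑ σ : Perm (Fin m), -(((Equiv.Perm.sign σ : ℤ) : ℂ) •
            rename (Equiv.prodCongr σ (1 : Perm (Fin m))) (monomial α (coeff α q))) := by
            refine Finset.sum_congr rfl fun σ _ => ?_
            rw [Equiv.Perm.sign_mul, Equiv.Perm.sign_swap hii', Units.val_mul, Units.val_neg, Units.val_one,
              Int.cast_mul, Int.cast_neg, Int.cast_one, mul_neg, mul_one, neg_smul, hcomp σ, ← rename_rename, hfix]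
        _ = -S := by rw [Finset.sum_neg_distrib]
    have h2 : (2 : ℂ) • S = 0 := by rw [two_smul]; nth_rw 2 [hneg]; exact add_neg_cancel S
    rw [← one_smul ℂ S, ← inv_mul_cancel₀ (two_ne_zero (α := ℂ)), ← smul_smul, h2, smul_zero]
  rw [q.as_sum]; simp_rw [map_sum, Finset.smul_sum]; rw [Finset.sum_comm]
  exact Finset.sum_eq_zero key

/-- Column version of `sum_sign_smul_rename_row_eq_zero` (transport along `Prod.swap`). [folklore] -/
theorem sum_sign_smul_rename_col_eq_zero {m : ℕ} {q : MvPolynomial (Fin m × Fin m) ℂ} (hq : q.totalDegree + 2 ≤ m) :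
    ∑ τ : Perm (Fin m), ((Equiv.Perm.sign τ : ℤ) : ℂ) • rename (Equiv.prodCongr (1 : Perm (Fin m)) τ) q = 0 := by
  have hq' : (rename Prod.swap q).totalDegree + 2 ≤ m := (Nat.add_le_add_right (totalDegree_rename_le _ _) 2).trans hq
  have hfun : ∀ τ : Perm (Fin m), ((Prod.swap ∘ ⇑(Equiv.prodCongr τ (1 : Perm (Fin m)))) ∘ Prod.swap :
      Fin m × Fin m → Fin m × Fin m) = ⇑(Equiv.prodCongr (1 : Perm (Fin m)) τ) :=
    fun τ => funext fun ⟨a, b⟩ => rfl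
  calc ∑ τ : Perm (Fin m), ((Equiv.Perm.sign τ : ℤ) : ℂ) • rename (Equiv.prodCongr (1 : Perm (Fin m)) τ) q
      = ∑ τ : Perm (Fin m), rename Prod.swap (((Equiv.Perm.sign τ : ℤ) : ℂ) •
          rename (Equiv.prodCongr τ (1 : Perm (Fin m))) (rename Prod.swap q)) :=
        Finset.sum_congr rfl fun τ _ => by rw [map_smul, rename_rename, rename_rename, hfun]
    _ = rename Prod.swap (∑ τ : Perm (Fin m), ((Equiv.Perm.sign τ : ℤ) : ℂ) •
          rename (Equiv.prodCongr τ (1 : Perm (Fin m))) (rename Prod.swap q)) := (map_sum _ _ _).symm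
    _ = 0 := by rw [sum_sign_smul_rename_row_eq_zero hq', map_zero]

/-! ## §2 Partition bookkeeping -/

/-- A partition of `n` with a part `≥ n` has exactly one part. [folklore] -/
theorem card_parts_le_one_of_le_part {n : ℕ} (μ : Nat.Partition n) {a : ℕ} (ha : a ∈ μ.parts) (hna : n ≤ a) :
    μ.parts.card ≤ 1 := by
  obtain ⟨t, ht⟩ := Multiset.exists_cons_of_mem ha
  have hsum := μ.parts_sum
  rw [ht, Multiset.sum_cons] at hsum
  have hct : t.card ≤ t.sum := by
    simpa using Multiset.card_nsmul_le_sum fun b hb =>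
      (μ.parts_pos (by rw [ht]; exact Multiset.mem_cons_of_mem hb) : 1 ≤ b)
  rw [ht, Multiset.card_cons]
  omega

/-- A partition of `n` with `≥ n` parts is `(1ⁿ)`. [folklore] -/
theorem parts_eq_replicate_of_le_card {n : ℕ} (μ : Nat.Partition n) (h : n ≤ μ.parts.card) :
    μ.parts = Multiset.replicate n 1 := by
  have hpos : ∀ b ∈ μ.parts, 1 ≤ b := fun b hb => μ.parts_pos hb
  have hcs : μ.parts.card ≤ μ.parts.sum := by simpa using Multiset.card_nsmul_le_sum hpos
  rw [μ.parts_sum] at hcs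
  refine Multiset.eq_replicate.2 ⟨by omega, fun b hb => ?_⟩
  obtain ⟨t, ht⟩ := Multiset.exists_cons_of_mem hb
  have hct : t.card ≤ t.sum := by
    simpa using Multiset.card_nsmul_le_sum fun x hx => hpos x (by rw [ht]; exact Multiset.mem_cons_of_mem hx)
  have hsum := μ.parts_sum
  rw [ht, Multiset.sum_cons] at hsum
  rw [ht, Multiset.card_cons] at h
  have hb1 := hpos b hb
  omega

/-! ## §3 The abstract non-abelian floor -/

section Abstract

variable {m : ℕ} {V : Type} [AddCommGroup V] [Module ℂ V] (ρ : Representation ℂ (Perm (Fin m) × Perm (Fin m)) V)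

/-- Pulling the ROW sum out of a box-product weighted sum over `𝔖_m × 𝔖_m`. [folklore] -/
theorem sum_boxProd_smul_eq_row (v : V) (C : ℂ) (a b : Perm (Fin m) → ℂ) :
    ∑ t : Perm (Fin m) × Perm (Fin m), (C * (a t.1 * b t.2)) • ρ t⁻¹ v =
      ∑ h : Perm (Fin m), (C * b h) • ρ (1, h⁻¹) (∑ g : Perm (Fin m), a g • ρ (g⁻¹, 1) v) := by
  rw [Fintype.sum_prod_type, Finset.sum_comm]
  refine Finset.sum_congr rfl fun h _ => ?_
  rw [map_sum, Finset.smul_sum]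
  refine Finset.sum_congr rfl fun g _ => ?_
  try dsimp only
  rw [Prod.inv_mk, show ((g⁻¹, h⁻¹) : Perm (Fin m) × Perm (Fin m)) = (1, h⁻¹) * (g⁻¹, 1) by
    rw [Prod.mk_mul_mk, one_mul, mul_one], map_mul, Module.End.mul_apply, map_smul, smul_smul]
  congr 1
  ring

/-- Pulling the COLUMN sum out of a box-product weighted sum over `𝔖_m × 𝔖_m`. [folklore] -/
theorem sum_boxProd_smul_eq_col (v : V) (C : ℂ) (a b : Perm (Fin m) → ℂ) :
    ∑ t : Perm (Fin m) × Perm (Fin m), (C * (a t.1 * b t.2)) • ρ t⁻¹ v =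
      ∑ g : Perm (Fin m), (C * a g) • ρ (g⁻¹, 1) (∑ h : Perm (Fin m), b h • ρ (1, h⁻¹) v) := by
  rw [Fintype.sum_prod_type]
  refine Finset.sum_congr rfl fun g _ => ?_
  rw [map_sum, Finset.smul_sum]
  refine Finset.sum_congr rfl fun h _ => ?_
  try dsimp only
  rw [Prod.inv_mk, show ((g⁻¹, h⁻¹) : Perm (Fin m) × Perm (Fin m)) = (g⁻¹, 1) * (1, h⁻¹) by
    rw [Prod.mk_mul_mk, one_mul, mul_one], map_mul, Module.End.mul_apply, map_smul, smul_smul]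
  congr 1
  ring

variable [FiniteDimensional ℂ V]

/-- **Abstract floor.** In a finite-dimensional `ℂ[𝔖_m × 𝔖_m]`-module (`m ≥ 5`) a non-zero vector killed by the
row and column symmetrisers and antisymmetrisers forces `(m-1)² ≤ dim V`: its isotypic type `χ^λ ⊠ χ^μ` has
`λ, μ ∉ {(m), (1ᵐ)}`, so `dim V ≥ f^λ f^μ ≥ (m-1)²`. [cite: JamesLNM682, 6.6–6.7; FultonHarrisGTM129, §4.1] -/
theorem sq_sub_one_le_finrank (hm : 5 ≤ m) {v : V} (hv : v ≠ 0) (h₁ : ∑ σ : Perm (Fin m), ρ (σ, 1) v = 0)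
    (h₂ : ∑ σ : Perm (Fin m), ((Equiv.Perm.sign σ : ℤ) : ℂ) • ρ (σ, 1) v = 0)
    (h₃ : ∑ τ : Perm (Fin m), ρ (1, τ) v = 0)
    (h₄ : ∑ τ : Perm (Fin m), ((Equiv.Perm.sign τ : ℤ) : ℂ) • ρ (1, τ) v = 0) :
    (m - 1) ^ 2 ≤ Module.finrank ℂ V := by
  classical
  -- a non-zero isotypic component, of box-product type `χ^λ ⊠ χ^μ`
  have hsum : ∑ χ ∈ (irrChars_finite_holds _).toFinset, isotypicProj ρ χ v ≠ 0 := by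
    rw [sum_isotypicProj_apply]
    exact hv
  obtain ⟨χ, hχT, hPne⟩ := Finset.exists_ne_zero_of_sum_ne_zero hsum
  have hχ : χ ∈ irrChars (Perm (Fin m) × Perm (Fin m)) := (irrChars_finite_holds _).mem_toFinset.mp hχT
  obtain ⟨ψ, hψ, φ, hφ, hχeq⟩ := exists_eq_boxProd_of_mem_irrChars hχ
  rw [irrChars_perm_eq] at hψ hφ
  obtain ⟨la, rfl⟩ := hψ
  obtain ⟨mu, rfl⟩ := hφ
  have hχt : ∀ t : Perm (Fin m) × Perm (Fin m), χ t = spechtCharacter ℂ la t.1 * spechtCharacter ℂ mu t.2 :=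
    fun t => by rw [hχeq]
  have hinv : ∀ f : Perm (Fin m) → V, ∑ g : Perm (Fin m), f g⁻¹ = ∑ g : Perm (Fin m), f g :=
    fun f => Fintype.sum_equiv (Equiv.inv _) _ _ fun _ => rfl
  have hinvs : ∀ f : Perm (Fin m) → V, ∑ g : Perm (Fin m), ((Equiv.Perm.sign g : ℤ) : ℂ) • f g⁻¹ =
      ∑ g : Perm (Fin m), ((Equiv.Perm.sign g : ℤ) : ℂ) • f g :=
    fun f => Fintype.sum_equiv (Equiv.inv _) _ _ fun g => by rw [Equiv.inv_apply, Equiv.Perm.sign_inv]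
  have hrow : ∑ g : Perm (Fin m), spechtCharacter ℂ la g • ρ (g⁻¹, 1) v ≠ 0 := fun h0 => hPne (by
    rw [isotypicProj_apply]
    simp_rw [hχt]
    rw [sum_boxProd_smul_eq_row ρ v _ (spechtCharacter ℂ la) (spechtCharacter ℂ mu), h0]
    simp)
  have hcol : ∑ h : Perm (Fin m), spechtCharacter ℂ mu h • ρ (1, h⁻¹) v ≠ 0 := fun h0 => hPne (by
    rw [isotypicProj_apply]
    simp_rw [hχt]
    rw [sum_boxProd_smul_eq_col ρ v _ (spechtCharacter ℂ la) (spechtCharacter ℂ mu), h0]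
    simp)
  -- hence `λ, μ ∉ {(m), (1ᵐ)}` and `f^λ, f^μ ≥ m - 1`
  have hla₁ : ¬ la.parts.card ≤ 1 := fun hc => hrow (by
    simp_rw [spechtCharacter_eq_one_of_card_parts_le_one la hc, one_smul]; rw [hinv (fun g => ρ (g, 1) v), h₁])
  have hla₂ : la.parts ≠ Multiset.replicate m 1 := fun hc => hrow (by
    simp_rw [spechtCharacter_of_parts_eq_replicate_one la hc]; rw [hinvs (fun g => ρ (g, 1) v), h₂])
  have hmu₁ : ¬ mu.parts.card ≤ 1 := fun hc => hcol (by
    simp_rw [spechtCharacter_eq_one_of_card_parts_le_one mu hc, one_smul]; rw [hinv (fun g => ρ (1, g) v), h₃])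
  have hmu₂ : mu.parts ≠ Multiset.replicate m 1 := fun hc => hcol (by
    simp_rw [spechtCharacter_of_parts_eq_replicate_one mu hc]; rw [hinvs (fun g => ρ (1, g) v), h₄])
  have hfla : m - 1 ≤ numStandardTableaux la := sub_one_le_numStandardTableaux hm la
    (fun a ha => by by_contra h; exact hla₁ (card_parts_le_one_of_le_part la ha (by omega)))
    (by by_contra h; exact hla₂ (parts_eq_replicate_of_le_card la (by omega)))
  have hfmu : m - 1 ≤ numStandardTableaux mu := sub_one_le_numStandardTableaux hm mu
    (fun a ha => by by_contra h; exact hmu₁ (card_parts_le_one_of_le_part mu ha (by omega)))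
    (by by_contra h; exact hmu₂ (parts_eq_replicate_of_le_card mu (by omega)))
  -- dimension count on the isotypic component `V_χ = range P_χ ∋ P_χ v ≠ 0`
  obtain ⟨W, _, _, _, τ, hτ, hτχ⟩ := hχ
  haveI := hτ
  have hdim := finrank_range_isotypicProj_eq_mul_finrank_intertwiningMap ρ τ
  rw [hτχ] at hdim
  have hdimN : Module.finrank ℂ ↥(LinearMap.range (isotypicProj ρ χ)) =
      Module.finrank ℂ W * Module.finrank ℂ (Representation.IntertwiningMap τ ρ) := by exact_mod_cast hdim
  have hW : Module.finrank ℂ W = numStandardTableaux la * numStandardTableaux mu := by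
    have h1 := Representation.char_one τ
    rw [hτχ, hχt, Prod.fst_one, Prod.snd_one, spechtCharacter_one_eq_numStandardTableaux,
      spechtCharacter_one_eq_numStandardTableaux] at h1
    exact_mod_cast h1.symm
  have hpos : Module.finrank ℂ ↥(ℂ ∙ isotypicProj ρ χ v) ≤ Module.finrank ℂ ↥(LinearMap.range (isotypicProj ρ χ)) :=
    Submodule.finrank_mono ((Submodule.span_singleton_le_iff_mem _ _).2 (LinearMap.mem_range_self _ _))
  rw [finrank_span_singleton hPne] at hpos
  have hk : 0 < Module.finrank ℂ (Representation.IntertwiningMap τ ρ) := by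
    refine Nat.pos_of_ne_zero fun hk => ?_
    rw [hk, mul_zero] at hdimN
    omega
  calc (m - 1) ^ 2 = (m - 1) * (m - 1) := sq _
    _ ≤ numStandardTableaux la * numStandardTableaux mu := Nat.mul_le_mul hfla hfmu
    _ = Module.finrank ℂ W := hW.symm
    _ ≤ Module.finrank ℂ ↥(LinearMap.range (isotypicProj ρ χ)) := by rw [hdimN]; exact Nat.le_mul_of_pos_right _ hk
    _ ≤ Module.finrank ℂ V := Submodule.finrank_le _

end Abstract

/-! ## §4 The leaf: `(m-1)² ≤ idealWidth (biPermSubst m) per_m d` on the whole interior -/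

/-- **Non-abelian floor, `0 < d ≤ m - 2`** (`m ≥ 5`): every window-stable degree-`d` cut of `per_m` by `r` forms has
`(m-1)² ≤ r`.  Test vector `v = (1 - (1,c))(1 - (c,1)) p ∈ span s`. [folklore] -/
theorem sq_sub_one_le_of_hasIdealWidthLE {m d r : ℕ} (hm : 5 ≤ m) (hd : 0 < d) (hdm : d + 2 ≤ m)
    (h : HasIdealWidthLE (biPermSubst m) (perPoly (Fin m) ℂ) d r) : (m - 1) ^ 2 ≤ r := by
  classical
  haveI : NeZero m := ⟨by omega⟩
  obtain ⟨s, hcard, hhom, hstab, hmem⟩ := h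
  set W : Submodule ℂ (MvPolynomial (Fin m × Fin m) ℂ) :=
    Submodule.span ℂ (s : Set (MvPolynomial (Fin m × Fin m) ℂ))
  haveI : FiniteDimensional ℂ W := FiniteDimensional.span_finset ℂ s
  -- `W = span s` is a `𝔖_m × 𝔖_m`-module (window-stability)
  have hW : ∀ (g : Perm (Fin m) × Perm (Fin m)) (w : MvPolynomial (Fin m × Fin m) ℂ),
      w ∈ W → (rename (Equiv.prodCongr g.1 g.2)).toLinearMap w ∈ W := fun g w hw =>
    (Submodule.map_span_le _ _ _).2 (fun p hp => rename_prodCongr_mem_span hstab g.1 g.2 hp) (Submodule.mem_map_of_mem hw)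
  have hcomp : ∀ a b : Perm (Fin m) × Perm (Fin m), (⇑(Equiv.prodCongr a.1 a.2) ∘ ⇑(Equiv.prodCongr b.1 b.2) :
      Fin m × Fin m → Fin m × Fin m) = ⇑(Equiv.prodCongr (a * b).1 (a * b).2) :=
    fun a b => funext fun ⟨i, j⟩ => rfl
  have hid : (⇑(Equiv.prodCongr (1 : Perm (Fin m) × Perm (Fin m)).1 (1 : Perm (Fin m) × Perm (Fin m)).2) :
      Fin m × Fin m → Fin m × Fin m) = id := funext fun ⟨i, j⟩ => rfl
  let ρ : Representation ℂ (Perm (Fin m) × Perm (Fin m)) W :=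
    { toFun := fun g => ((rename (Equiv.prodCongr g.1 g.2)).toLinearMap).restrict (hW g)
      map_one' := LinearMap.ext fun w => Subtype.ext (by
        simp only [LinearMap.coe_restrict_apply, AlgHom.toLinearMap_apply, Module.End.one_apply, hid, rename_id_apply])
      map_mul' := fun a b => LinearMap.ext fun w => Subtype.ext (by
        simp only [LinearMap.coe_restrict_apply, AlgHom.toLinearMap_apply, Module.End.mul_apply, rename_rename, hcomp]) }
  have hρ : ∀ (g : Perm (Fin m) × Perm (Fin m)) (x : W), ((ρ g x : W) : MvPolynomial (Fin m × Fin m) ℂ) =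
      rename (Equiv.prodCongr g.1 g.2) (x : MvPolynomial (Fin m × Fin m) ℂ) := fun _ _ => rfl
  -- a cut form `p ∈ s` not vanishing at the test point `x_{ζ,ζ}`
  obtain ⟨ζ, hζ⟩ : ∃ ζ : ℂ, IsPrimitiveRoot ζ m := ⟨_, Complex.isPrimitiveRoot_exp m (by omega)⟩
  have hζm : ζ ^ m = 1 := hζ.pow_eq_one
  have hζ0 : ζ ≠ 0 := ne_zero_of_pow_eq_one' hζm
  have hζd : ζ ^ d ≠ 1 := hζ.pow_ne_one_of_pos_of_lt (by omega) (by omega)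
  obtain ⟨p, hp, hpx⟩ := exists_eval_ne_zero_of_mem_idealSpan hmem (eval_powPoint_perPoly_ne_zero m hζ0 hζ0)
  set x : Fin m × Fin m → ℂ := fun ij => ζ ^ (ij.1 : ℕ) * ζ ^ (ij.2 : ℕ) with hxdef
  have hps : (p : MvPolynomial (Fin m × Fin m) ℂ) ∈ W := Submodule.subset_span hp
  -- the test vector `v = (1 - (1,c))(1 - (c,1)) p`, `c` the `m`-cycle
  set u : Fin m := ⟨1, by omega⟩ with hudef
  set c : Perm (Fin m) := Equiv.addRight u with hcdef
  set w : W := ⟨p, hps⟩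
  set v₀ : W := w - ρ (c, 1) w
  set v : W := v₀ - ρ (1, c) v₀
  have h01 : (1 : Perm (Fin m)) = Equiv.addRight (⟨0, by omega⟩ : Fin m) :=
    Equiv.ext fun i => Fin.ext (by simp)
  have hcc : ρ (1, c) (ρ (c, 1) w) = ρ (c, c) w := by
    show (ρ (1, c) * ρ (c, 1)) w = ρ (c, c) w
    rw [← map_mul, Prod.mk_mul_mk, one_mul, mul_one]
  have hvcoe : ((v : W) : MvPolynomial (Fin m × Fin m) ℂ) = p - rename (Equiv.prodCongr c (1 : Perm (Fin m))) p -
      (rename (Equiv.prodCongr (1 : Perm (Fin m)) c) p - rename (Equiv.prodCongr c c) p) := by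
    show ((w - ρ (c, 1) w - ρ (1, c) (w - ρ (c, 1) w) : W) : MvPolynomial (Fin m × Fin m) ℂ) = _
    rw [map_sub, hcc]
    rfl
  have hvx : eval x ((v : W) : MvPolynomial (Fin m × Fin m) ℂ) = (1 - ζ ^ d) ^ 2 * eval x p := by
    rw [hvcoe, h01]
    simp only [map_sub, hcdef, hudef, hxdef, eval_rename_shift_powPoint hζm hζm (hhom p hp), pow_zero, pow_one,
      mul_one, one_mul]
    ring
  have hv : v ≠ 0 := fun h0 => mul_ne_zero (pow_ne_zero 2 (sub_ne_zero.2 hζd.symm)) hpx (by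
    rw [← hvx, h0, Submodule.coe_zero, map_zero])
  have hdeg : ((v : W) : MvPolynomial (Fin m × Fin m) ℂ).totalDegree + 2 ≤ m := by
    have hpd : p.totalDegree ≤ d := (hhom p hp).totalDegree_le
    have hr : ∀ f : Fin m × Fin m → Fin m × Fin m, (rename f p).totalDegree ≤ d :=
      fun f => (totalDegree_rename_le f p).trans hpd
    have h3 := (totalDegree_sub _ _).trans (max_le ((totalDegree_sub _ _).trans (max_le hpd
      (hr (Equiv.prodCongr c (1 : Perm (Fin m)))))) ((totalDegree_sub _ _).trans (max_le
      (hr (Equiv.prodCongr (1 : Perm (Fin m)) c)) (hr (Equiv.prodCongr c c)))))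
    rw [hvcoe]
    omega
  -- symmetriser sums vanish by reindexing `σ ↦ σ c`
  have hsym₀ : ∑ σ : Perm (Fin m), ρ (σ, 1) v₀ = 0 := by
    show ∑ σ : Perm (Fin m), ρ (σ, 1) (w - ρ (c, 1) w) = 0
    simp only [map_sub, Finset.sum_sub_distrib]
    rw [sub_eq_zero]
    refine (Fintype.sum_equiv (Equiv.mulRight c) _ _ fun σ => ?_).symm
    show (ρ (σ, 1) * ρ (c, 1)) w = ρ (Equiv.mulRight c σ, 1) w
    rw [← map_mul, Prod.mk_mul_mk, mul_one, Equiv.coe_mulRight]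
  have h₁ : ∑ σ : Perm (Fin m), ρ (σ, 1) v = 0 := by
    show ∑ σ : Perm (Fin m), ρ (σ, 1) (v₀ - ρ (1, c) v₀) = 0
    simp only [map_sub, Finset.sum_sub_distrib, hsym₀, zero_sub, neg_eq_zero]
    have hc : ∀ σ : Perm (Fin m), ρ (σ, 1) (ρ (1, c) v₀) = ρ (1, c) (ρ (σ, 1) v₀) := fun σ => by
      show (ρ (σ, 1) * ρ (1, c)) v₀ = (ρ (1, c) * ρ (σ, 1)) v₀
      rw [← map_mul, ← map_mul, Prod.mk_mul_mk, Prod.mk_mul_mk, one_mul, mul_one, one_mul, mul_one]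
    simp_rw [hc]
    rw [← map_sum, hsym₀, map_zero]
  have h₃ : ∑ τ : Perm (Fin m), ρ (1, τ) v = 0 := by
    show ∑ τ : Perm (Fin m), ρ (1, τ) (v₀ - ρ (1, c) v₀) = 0
    simp only [map_sub, Finset.sum_sub_distrib]
    rw [sub_eq_zero]
    refine (Fintype.sum_equiv (Equiv.mulRight c) _ _ fun τ => ?_).symm
    show (ρ (1, τ) * ρ (1, c)) v₀ = ρ (1, Equiv.mulRight c τ) v₀
    rw [← map_mul, Prod.mk_mul_mk, mul_one, Equiv.coe_mulRight]
  have h₂ : ∑ σ : Perm (Fin m), ((Equiv.Perm.sign σ : ℤ) : ℂ) • ρ (σ, 1) v = 0 := by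
    apply Subtype.coe_injective
    simp only [Submodule.coe_sum, Submodule.coe_smul, Submodule.coe_zero, hρ]
    exact sum_sign_smul_rename_row_eq_zero hdeg
  have h₄ : ∑ τ : Perm (Fin m), ((Equiv.Perm.sign τ : ℤ) : ℂ) • ρ (1, τ) v = 0 := by
    apply Subtype.coe_injective
    simp only [Submodule.coe_sum, Submodule.coe_smul, Submodule.coe_zero, hρ]
    exact sum_sign_smul_rename_col_eq_zero hdeg
  calc (m - 1) ^ 2 ≤ Module.finrank ℂ W := sq_sub_one_le_finrank ρ hm hv h₁ h₂ h₃ h₄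
    _ ≤ s.card := finrank_span_finset_le_card s
    _ ≤ r := hcard

/-- **The floor on the leaf**: `(m-1)² ≤ idealWidth (biPermSubst m) per_m d` for `m ≥ 5` and EVERY `0 < d < m`
(wherever a window-stable degree-`d` cut exists at all; `d ≤ m - 2` by `sq_sub_one_le_of_hasIdealWidthLE`, the
coprime column `d = m - 1` is worth `m² ≥ (m-1)²`).  In particular the middle cut `2d = m`, where the abelian
bound of `EquivariantDialLayersCharacters` is `4`. -/
theorem sq_sub_one_le_idealWidth {m d : ℕ} (hm : 5 ≤ m) (hd : 0 < d) (hdm : d < m)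
    (hne : ∃ r, HasIdealWidthLE (biPermSubst m) (perPoly (Fin m) ℂ) d r) :
    (m - 1) ^ 2 ≤ idealWidth (biPermSubst m) (perPoly (Fin m) ℂ) d := by
  obtain ⟨r, hr⟩ := hne
  unfold idealWidth
  refine le_csInf ⟨r, hr⟩ fun r' hr' => ?_
  rcases Nat.lt_or_ge (d + 1) m with hlt | hge
  · exact sq_sub_one_le_of_hasIdealWidthLE hm hd (by omega) hr'
  · have hcop : Nat.Coprime m d := by
      rw [show d = m - 1 by omega]
      exact (Nat.coprime_self_sub_right (by omega)).2 (Nat.coprime_one_right _)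
    exact (Nat.pow_le_pow_left (Nat.sub_le m 1) 2).trans (sq_le_of_hasIdealWidthLE_of_coprime (by omega) hcop hr')

/-- Record floor of the leaf: `max ((m / gcd(m,d))², (m-1)²) ≤ idealWidth` (`m ≥ 5`, `0 < d < m`). -/
theorem max_sq_le_idealWidth {m d : ℕ} (hm : 5 ≤ m) (hd : 0 < d) (hdm : d < m)
    (hne : ∃ r, HasIdealWidthLE (biPermSubst m) (perPoly (Fin m) ℂ) d r) :
    max ((m / Nat.gcd m d) ^ 2) ((m - 1) ^ 2) ≤ idealWidth (biPermSubst m) (perPoly (Fin m) ℂ) d :=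
  max_le (sq_div_gcd_le_idealWidth (by omega) hne) (sq_sub_one_le_idealWidth hm hd hdm hne)

end Summit.ValiantsHypothesis.ValiantsHypothesis.Theorems.EquivariantDialLayersSpecht
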